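import Summits.QuantumFields.BalabanUV.T4Continuum.Support.GaugeTermSandwichBound

/-!
# T⁴ programme, spine node NE2 (U1a) — THE SANDWICHED COVARIANT-DIVERGENCE PLANTING DATUM (tier B, supplier row B4.f of
# `t4/formal/NE2/LEAVES.md`): `Θ = D′_Rᴴ·(J ⊗ 1) − (J⁰ ⊗ 1)·D_Rᴴ` at two levels, its exact split and its bound through `𝒢`

NE2 formalisation swarm `t4-ne2-formalise-*`, seat LEAF 10 (unit `b2b-balaban-t4-ne2-formalise-leaf-10`), third file (rows B4.a:
`Support/GaugeTermDecomposition` p207876, `Support/GaugeTermSandwichBound` p208020).  Row B4.b (`Support/GaugeTermSandwichLaw`) reads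
the gauge summand of Bałaban's operator ([Balaban1985BackgroundPropagators] (3.25)–(3.26) pp.394–395) FACTORISED, `D_R·P·D_Rᴴ = Zᴴ·N·Z`
with `Z = Q′G′D_Rᴴ`; its two-level consistency input `ζ_k = ‖(Z_{k+1}J_k − Z_k)D_k⁻¹‖` splits as
`Z_{k+1}J_k − Z_k = Q′_{k+1}G′_{k+1}·Θ_k + (Q′_{k+1}G′_{k+1}J⁰_k − Q′_kG′_k)·D_{R,k}ᴴ`, `Θ_k := D′_Rᴴ·(J_k ⊗ 1) − (J⁰_k ⊗ 1)·D_Rᴴ`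
(`J` King's pairing on 1-forms, `J⁰` the same pairing on 0-forms).  This file supplies the `Θ`-piece at two levels `η = 1/N`,
`η′ = η/R` (pattern of `Support/FirstOrderAdjointModel` §2–§3), with the left factor — the perturbed scalar resolvent of row B4.b —
as DATA:

 * §1 the SCALAR KING PAIRING `JK0 N R M` (entries `√(R^d)·R^{−d}·[par x′ = y]`) and its intertwiners with the component injections of
   `GaugeTermDecomposition`: `JK·injM_μ = injM′_μ·JK0`, `JK0·injM_μᴴ = injM′_μᴴ·JK`, `JK0ᴴJK0 = 1`, `‖JK0‖ ≤ 1`, the scalar block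
   projection `Pi0 = JK0·JK0ᴴ` with `Π·injM′_μ = injM′_μ·Π₀`; the backward-shift planting identity
   **`shiftH_mul_JK_sub`** `S′ᴴJ − JSᴴ = S′ᴴ(1 − F)J(1 − Sᴴ)` (from the tree's `shift_sub_one_mul_JK`);
 * §2 the objects `divPlant` (`Θ`), `Yfree = Σ_μ (injM′_μᴴ(∇′_μᴴJ − J∇_μᴴ)) ⊗ 1`, `Wpart` and the EXACT SPLIT
   **`divPlant_eq`**: `Θ = ((1 − Π₀′) ⊗ 1)·Yfree + Wpart` — the free part carries the complement projection (tree
   `Pi_mul_adjoint_defect`: `Π(∇′ᴴJ − J∇ᴴ) = 0`), the connection part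
   `Wpart = Σ_μ (injM′_μᴴ ⊗ 1)[(S′_μᴴ ⊗ 1)·siteMul(w̄′_μ − w̄_μ∘parT)·(J ⊗ 1) + ((S′_μᴴ(1 − F_μ)J(1 − S_μᴴ)) ⊗ 1)·siteMul(w̄_μ)]`;
 The companion file `Support/CovariantDivergencePlantingBound` bounds the two parts through the coarse vector propagator
 `𝒢 = calG N ⊗ 1` ([Balaban1984PropagatorsI] (1.89) via the tree): `‖Yfree·𝒢‖ ≤ d(R + 1)Cst`, `‖Wpart·𝒢‖ ≤ d(β′ + 2(α + β))Cst/N`, and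
 the END `‖Gs·Θ·(𝒢 ⊗ 1)‖ ≤ c₀·d(R + 1)Cst + g·d(β′ + 2(α + β))Cst/N` for any left factor `Gs` with `‖Gs‖ ≤ g`, `‖Gs((1 − Π₀′) ⊗ 1)‖ ≤ c₀`.

HONEST FRAMING (T4-DAG p. 1).  [folklore] lattice bookkeeping OURS; the only printed input is (1.89) through the tree's kernel theorems;
transporters and the left factor are DATA (the perturbed scalar resolvent and its complement law `c₀ = O(L^{−k})` are rows B4.b/B4.d/B4.e,
not claimed here); finite torus, linear layer, operator norm, model level (trigger c5); NOT [B9] (3.23)–(3.26) as printed; NE2 NOT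
proved; NOT infinite volume / mass gap / Clay / summit progress; spine 0/9 unchanged.  HONEST DEPENDENCY: continuum YM on T⁴ ⇐ BetaPertH ∧
nine spine estimates (0/9 proved); BetaPertH ⇐ (D1) ∧ (D4) ∧ CAP+tail; G-an2-4 gates asym, D1 and NE2/3/4.  ABSOLUTE RULE kept; no `sorry`.
-/

noncomputable section

open scoped BigOperators ComplexConjugate Matrix Matrix.Norms.L2Operator Kronecker

namespace Summit.QuantumFields.BalabanUV.T4Continuum.CovariantDivergencePlanting

open Literature.MathematicalPhysics.QuantumFieldTheory.Balaban1983to89.B5Prop11Plancherel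
open Literature.MathematicalPhysics.QuantumFieldTheory.Balaban1983to89.B5Action121 (shiftS sdiff GradOp)
open Summit.QuantumFields.BalabanUV.T4Continuum
open Summit.QuantumFields.BalabanUV.T4Continuum.BalabanAveragedTowerModes (par)
open Summit.QuantumFields.BalabanUV.T4Continuum.BalabanBlockPoincare (Pi)
open Summit.QuantumFields.BalabanUV.T4Continuum.KingPairingPlantedLaw (JK JK_conjTranspose_mul_JK JK_mul_conjTranspose opNorm_JK_le
  Pi_conjTranspose)
open Summit.QuantumFields.BalabanUV.T4Continuum.BlockPairingGeometry (tau parT faceF JK_apply shift_sub_one_mul_JK opNorm_shiftM_le)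
open Summit.QuantumFields.BalabanUV.T4Continuum.BlockPairingFaces (opNorm_faceF_le opNorm_calG_mul_fdiff_le)
open Summit.QuantumFields.BalabanUV.T4Continuum.FirstOrderAdjointModel (conjTranspose_fdiff_eq conjTranspose_fdiff_mul_JK
  Pi_mul_adjoint_defect shiftM_mul_conjTranspose)
open Summit.QuantumFields.BalabanUV.T4Continuum.KroneckerLift
open Summit.QuantumFields.BalabanUV.T4Continuum.BlockMultiplication
open Summit.QuantumFields.BalabanUV.T4Continuum.KroneckerUnits
open Summit.QuantumFields.BalabanUV.T4Continuum.GaugeTermDecomposition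
open Summit.QuantumFields.BalabanUV.T4Continuum.GaugeTermSandwichBound

variable {d : ℕ}

/-! ## §1 King's pairing on 0-forms and its intertwiners -/

section TwoLevel

variable (N R : ℕ) [NeZero N] [NeZero R] (M : Fin d → ℕ) [hM : ∀ μ, NeZero (M μ)]

/-- **KING's PAIRING ON 0-FORMS**: the isometric block-constant injection of coarse scalar functions, entries `√(R^d)·R^{−d}·[par x′ = y]`
(the 1-form pairing `JK` acts by this on every component). [cite: King1986, (2.10) p.653, p.664] [folklore] -/
def JK0 : Matrix (Tor (fine (R * N) M)) (Tor (fine N M)) ℂ :=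
  fun x y => (((Real.sqrt ((R : ℝ) ^ d)) : ℝ) : ℂ) * (((R : ℂ) ^ d)⁻¹ * if par N R M x = y then 1 else 0)

/-- **`J·injM_μ = injM′_μ·J⁰`** (the 1-form pairing acts componentwise by the 0-form pairing). [folklore] -/
theorem JK_mul_injM (μ : Fin d) : JK N R M * injM (fine N M) μ = injM (fine (R * N) M) μ * JK0 N R M := by
  ext x y
  rw [Matrix.mul_apply, Finset.sum_eq_single (y, μ), Matrix.mul_apply, Finset.sum_eq_single x.1]
  · simp only [injM, JK_apply, JK0, parT, if_true, mul_one]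
    have e1 : (((par N R M x.1, x.2) : Tor (fine N M) × Fin d) = (y, μ)) ↔ (par N R M x.1 = y ∧ x.2 = μ) := Prod.mk.injEq _ _ _ _ |>.to_iff
    have e2 : (x = (x.1, μ)) ↔ x.2 = μ := by
      constructor
      · intro h; rw [h]
      · intro h; rw [← h]
    simp only [e1, e2]
    by_cases h2 : x.2 = μ <;> by_cases h1 : par N R M x.1 = y <;> simp [h1, h2]
  · intro z _ hz
    have : ¬ x = (z, μ) := fun h => hz (by rw [h])
    simp only [injM, if_neg this, zero_mul]
  · intro h; exact absurd (Finset.mem_univ _) h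
  · intro j _ hj
    simp only [injM, if_neg hj, mul_zero]
  · intro h; exact absurd (Finset.mem_univ _) h

/-- **`J⁰·injM_μᴴ = injM′_μᴴ·J`**. [folklore] -/
theorem JK0_mul_injMH (μ : Fin d) : JK0 N R M * (injM (fine N M) μ)ᴴ = (injM (fine (R * N) M) μ)ᴴ * JK N R M := by
  ext x j
  rw [Matrix.mul_apply, Finset.sum_eq_single j.1, Matrix.mul_apply, Finset.sum_eq_single (x, μ)]
  · simp only [injM_conjTranspose_apply, JK_apply, JK0, parT, if_true, one_mul]
    have e1 : (((par N R M x, μ) : Tor (fine N M) × Fin d) = j) ↔ (par N R M x = j.1 ∧ μ = j.2) := by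
      constructor
      · intro h; rw [← h]; exact ⟨rfl, rfl⟩
      · rintro ⟨h1, h2⟩; rw [h1, h2]
    have e2 : (j = (j.1, μ)) ↔ μ = j.2 := by
      constructor
      · intro h; rw [h]
      · intro h; rw [h]
    simp only [e1, e2]
    by_cases h2 : μ = j.2 <;> by_cases h1 : par N R M x = j.1 <;> simp [h1, h2]
  · intro i _ hi
    rw [injM_conjTranspose_apply, if_neg hi, zero_mul]
  · intro h; exact absurd (Finset.mem_univ _) h
  · intro z _ hz
    have : ¬ j = (z, μ) := fun h => hz (by rw [h])
    rw [injM_conjTranspose_apply, if_neg this, mul_zero]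
  · intro h; exact absurd (Finset.mem_univ _) h

/-- `Jᴴ·injM′_μ = injM_μ·J⁰ᴴ`. [folklore] -/
theorem JKH_mul_injM (μ : Fin d) : (JK N R M)ᴴ * injM (fine (R * N) M) μ = injM (fine N M) μ * (JK0 N R M)ᴴ := by
  have h := congrArg Matrix.conjTranspose (JK0_mul_injMH N R M μ)
  rw [Matrix.conjTranspose_mul, Matrix.conjTranspose_mul, Matrix.conjTranspose_conjTranspose, Matrix.conjTranspose_conjTranspose] at h
  exact h.symm

/-- `J⁰ = injM′_μᴴ·J·injM_μ` (any component). [folklore] -/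
theorem JK0_eq (μ : Fin d) : JK0 N R M = (injM (fine (R * N) M) μ)ᴴ * JK N R M * injM (fine N M) μ := by
  rw [Matrix.mul_assoc, JK_mul_injM, ← Matrix.mul_assoc, conjTranspose_injM_mul_injM, Matrix.one_mul]

/-- **`J⁰ᴴJ⁰ = 1`** (an isometry; `d ≥ 1`). [folklore] -/
theorem JK0_conjTranspose_mul_JK0 (hd : 1 ≤ d) : (JK0 N R M)ᴴ * JK0 N R M = 1 := by
  set μ : Fin d := ⟨0, hd⟩
  have h1 : (injM (fine (R * N) M) μ * JK0 N R M)ᴴ * (injM (fine (R * N) M) μ * JK0 N R M) = 1 := by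
    rw [← JK_mul_injM, Matrix.conjTranspose_mul, Matrix.mul_assoc, ← Matrix.mul_assoc (JK N R M)ᴴ, JK_conjTranspose_mul_JK,
      Matrix.one_mul, conjTranspose_injM_mul_injM]
  rw [Matrix.conjTranspose_mul, Matrix.mul_assoc, ← Matrix.mul_assoc (injM (fine (R * N) M) μ)ᴴ, conjTranspose_injM_mul_injM,
    Matrix.one_mul] at h1
  exact h1

/-- `‖J⁰‖ ≤ 1`. [folklore] -/
theorem opNorm_JK0_le (hd : 1 ≤ d) : ‖JK0 N R M‖ ≤ 1 := by
  have h1 : ‖JK0 N R M‖ * ‖JK0 N R M‖ ≤ 1 := by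
    rw [← Matrix.l2_opNorm_conjTranspose_mul_self, JK0_conjTranspose_mul_JK0 N R M hd, ← Matrix.diagonal_one, Matrix.l2_opNorm_diagonal]
    refine (pi_norm_le_iff_of_nonneg zero_le_one).mpr fun _ => ?_
    simp
  nlinarith [norm_nonneg (JK0 N R M)]

/-- the scalar block projection `Π₀ = J⁰J⁰ᴴ`. [folklore] -/
def Pi0 : Matrix (Tor (fine (R * N) M)) (Tor (fine (R * N) M)) ℂ := JK0 N R M * (JK0 N R M)ᴴ

/-- `Π·injM′_μ = injM′_μ·Π₀` (the 1-form block projection acts componentwise). [folklore] -/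
theorem Pi_mul_injM (μ : Fin d) : Pi N R M * injM (fine (R * N) M) μ = injM (fine (R * N) M) μ * Pi0 N R M := by
  rw [← JK_mul_conjTranspose, Matrix.mul_assoc, JKH_mul_injM, ← Matrix.mul_assoc, JK_mul_injM, Matrix.mul_assoc, Pi0]

/-- `injM′_μᴴ·(1 − Π) = (1 − Π₀)·injM′_μᴴ`. [folklore] -/
theorem injMH_mul_one_sub_Pi (μ : Fin d) :
    (injM (fine (R * N) M) μ)ᴴ * (1 - Pi N R M) = (1 - Pi0 N R M) * (injM (fine (R * N) M) μ)ᴴ := by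
  have h := congrArg Matrix.conjTranspose (Pi_mul_injM N R M μ)
  rw [Matrix.conjTranspose_mul, Matrix.conjTranspose_mul, Pi_conjTranspose, Pi0, Matrix.conjTranspose_mul,
    Matrix.conjTranspose_conjTranspose, ← Pi0] at h
  rw [Matrix.mul_sub, Matrix.sub_mul, Matrix.mul_one, Matrix.one_mul, h]

/-- `1 − Sᴴ = (S − 1)·Sᴴ`. [folklore] -/
theorem one_sub_shiftH (Nf : Fin d → ℕ) [∀ μ, NeZero (Nf μ)] (μ : Fin d) :
    (1 : Matrix (Tor Nf × Fin d) (Tor Nf × Fin d) ℂ) - (shiftM Nf μ)ᴴ = (shiftM Nf μ - 1) * (shiftM Nf μ)ᴴ := by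
  rw [Matrix.sub_mul, shiftM_mul_conjTranspose, Matrix.one_mul]

/-- **THE BACKWARD-SHIFT PLANTING IDENTITY** `S′ᴴJ − JSᴴ = S′ᴴ(1 − F)J(1 − Sᴴ)`: a backward fine step moves a block-constant field only
across the far face, and `1 − Sᴴ` is a coarse difference. [cite: King1986, (2.10) p.653] [folklore] -/
theorem shiftH_mul_JK_sub (μ : Fin d) :
    (shiftM (fine (R * N) M) μ)ᴴ * JK N R M - JK N R M * (shiftM (fine N M) μ)ᴴ
      = (shiftM (fine (R * N) M) μ)ᴴ * (1 - faceF N R M μ) * JK N R M * (1 - (shiftM (fine N M) μ)ᴴ) := by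
  have h1 : (1 - faceF N R M μ) * JK N R M * (shiftM (fine N M) μ - 1) = JK N R M * shiftM (fine N M) μ - shiftM (fine (R * N) M) μ * JK N R M := by
    rw [Matrix.sub_mul, Matrix.one_mul, Matrix.sub_mul, ← shift_sub_one_mul_JK, Matrix.mul_sub, Matrix.mul_one, Matrix.sub_mul,
      Matrix.one_mul]
    abel
  rw [one_sub_shiftH]
  symm
  calc (shiftM (fine (R * N) M) μ)ᴴ * (1 - faceF N R M μ) * JK N R M * ((shiftM (fine N M) μ - 1) * (shiftM (fine N M) μ)ᴴ)
      = (shiftM (fine (R * N) M) μ)ᴴ * ((1 - faceF N R M μ) * JK N R M * (shiftM (fine N M) μ - 1)) * (shiftM (fine N M) μ)ᴴ := by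
        simp only [Matrix.mul_assoc]
    _ = (shiftM (fine (R * N) M) μ)ᴴ * (JK N R M * shiftM (fine N M) μ - shiftM (fine (R * N) M) μ * JK N R M) * (shiftM (fine N M) μ)ᴴ := by
        rw [h1]
    _ = (shiftM (fine (R * N) M) μ)ᴴ * JK N R M * (shiftM (fine N M) μ * (shiftM (fine N M) μ)ᴴ)
          - (shiftM (fine (R * N) M) μ)ᴴ * shiftM (fine (R * N) M) μ * JK N R M * (shiftM (fine N M) μ)ᴴ := by
        simp only [Matrix.mul_sub, Matrix.sub_mul, Matrix.mul_assoc]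
    _ = (shiftM (fine (R * N) M) μ)ᴴ * JK N R M - JK N R M * (shiftM (fine N M) μ)ᴴ := by
        rw [shiftM_mul_conjTranspose, Matrix.mul_one, BlockPairingGeometry.conjTranspose_shiftM_mul, Matrix.one_mul]

end TwoLevel

/-! ## §2 The planting defect of the covariant divergence and its exact split -/

section Split

variable (N R : ℕ) [NeZero N] [NeZero R] (M : Fin d → ℕ) [hM : ∀ μ, NeZero (M μ)] {o : Type*} [Fintype o] [DecidableEq o]

/-- **THE PLANTING DEFECT OF THE COVARIANT DIVERGENCE** `Θ = D′_Rᴴ·(J ⊗ 1) − (J⁰ ⊗ 1)·D_Rᴴ` (fine transporters `R₁`, coarse `R₀`;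
lattice factors `RN`, `N`). [folklore] -/
def divPlant (R₁ : Fin d → (Tor (fine (R * N) M) → Matrix o o ℂ)) (R₀ : Fin d → (Tor (fine N M) → Matrix o o ℂ)) :
    Matrix (Tor (fine (R * N) M) × o) ((Tor (fine N M) × Fin d) × o) ℂ :=
  (covGrad (fine (R * N) M) (((R * N : ℕ)) : ℂ) R₁)ᴴ * (JK N R M ⊗ₖ (1 : Matrix o o ℂ))
    - (JK0 N R M ⊗ₖ (1 : Matrix o o ℂ)) * (covGrad (fine N M) ((N : ℕ) : ℂ) R₀)ᴴ

/-- the free part, scalar layer: `Y⁰ = Σ_μ injM′_μᴴ·(∇′_μᴴJ − J∇_μᴴ)`. [folklore] -/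
def YfreeS : Matrix (Tor (fine (R * N) M)) (Tor (fine N M) × Fin d) ℂ :=
  ∑ μ, (injM (fine (R * N) M) μ)ᴴ * ((fdiff (fine (R * N) M) (((R * N : ℕ)) : ℂ) μ)ᴴ * JK N R M
    - JK N R M * (fdiff (fine N M) ((N : ℕ) : ℂ) μ)ᴴ)

variable (o) in
/-- the free part `Y = Y⁰ ⊗ 1` (colour components explicit). [folklore] -/
def Yfree : Matrix (Tor (fine (R * N) M) × o) ((Tor (fine N M) × Fin d) × o) ℂ := YfreeS N R M ⊗ₖ (1 : Matrix o o ℂ)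

/-- the connection part, per direction: two-level consistency term + backward-shift planting term. [folklore] -/
def WpartDir (R₁ : Fin d → (Tor (fine (R * N) M) → Matrix o o ℂ)) (R₀ : Fin d → (Tor (fine N M) → Matrix o o ℂ)) (μ : Fin d) :
    Matrix (Tor (fine (R * N) M) × o) ((Tor (fine N M) × Fin d) × o) ℂ :=
  (injM (fine (R * N) M) μ)ᴴ ⊗ₖ (1 : Matrix o o ℂ)
    * (((shiftM (fine (R * N) M) μ)ᴴ ⊗ₖ (1 : Matrix o o ℂ))
        * siteMul (fun i' => (connL (fine (R * N) M) (((R * N : ℕ)) : ℂ) R₁ μ i')ᴴ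
            - (connL (fine N M) ((N : ℕ) : ℂ) R₀ μ (parT N R M i'))ᴴ)
        * (JK N R M ⊗ₖ (1 : Matrix o o ℂ))
      + ((shiftM (fine (R * N) M) μ)ᴴ * (1 - faceF N R M μ) * JK N R M * (1 - (shiftM (fine N M) μ)ᴴ)) ⊗ₖ (1 : Matrix o o ℂ)
        * siteMul (fun i => (connL (fine N M) ((N : ℕ) : ℂ) R₀ μ i)ᴴ))

/-- the connection part `W = Σ_μ WpartDir μ`. [folklore] -/
def Wpart (R₁ : Fin d → (Tor (fine (R * N) M) → Matrix o o ℂ)) (R₀ : Fin d → (Tor (fine N M) → Matrix o o ℂ)) :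
    Matrix (Tor (fine (R * N) M) × o) ((Tor (fine N M) × Fin d) × o) ℂ :=
  ∑ μ, WpartDir N R M R₁ R₀ μ

omit hM in
/-- the free part of the split, scalar layer: `∂′ᴴJ − J⁰∂ᴴ = (1 − Π₀′)·Y⁰` (`Π(∇′ᴴJ − J∇ᴴ) = 0`). [folklore] -/
theorem gradH_plant_sub_scalar [∀ μ, NeZero (M μ)] (hd : 1 ≤ d) (hN : 1 ≤ N) :
    (GradOp (fine (R * N) M) (((R * N : ℕ)) : ℂ))ᴴ * JK N R M - JK0 N R M * (GradOp (fine N M) ((N : ℕ) : ℂ))ᴴ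
      = (1 - Pi0 N R M) * YfreeS N R M := by
  have hμ : ∀ μ, (injM (fine (R * N) M) μ)ᴴ * ((fdiff (fine (R * N) M) (((R * N : ℕ)) : ℂ) μ)ᴴ * JK N R M
      - JK N R M * (fdiff (fine N M) ((N : ℕ) : ℂ) μ)ᴴ)
      = (1 - Pi0 N R M) * ((injM (fine (R * N) M) μ)ᴴ * ((fdiff (fine (R * N) M) (((R * N : ℕ)) : ℂ) μ)ᴴ * JK N R M
        - JK N R M * (fdiff (fine N M) ((N : ℕ) : ℂ) μ)ᴴ)) := by
    intro μ
    set X := (fdiff (fine (R * N) M) (((R * N : ℕ)) : ℂ) μ)ᴴ * JK N R M - JK N R M * (fdiff (fine N M) ((N : ℕ) : ℂ) μ)ᴴ with hX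
    have hPX : (1 - Pi N R M) * X = X := by
      rw [Matrix.sub_mul, Matrix.one_mul, hX, Pi_mul_adjoint_defect N R M hd hN μ, sub_zero]
    calc (injM (fine (R * N) M) μ)ᴴ * X = (injM (fine (R * N) M) μ)ᴴ * ((1 - Pi N R M) * X) := by rw [hPX]
      _ = (injM (fine (R * N) M) μ)ᴴ * (1 - Pi N R M) * X := by rw [Matrix.mul_assoc]
      _ = (1 - Pi0 N R M) * (injM (fine (R * N) M) μ)ᴴ * X := by rw [injMH_mul_one_sub_Pi]
      _ = (1 - Pi0 N R M) * ((injM (fine (R * N) M) μ)ᴴ * X) := by rw [Matrix.mul_assoc]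
  rw [GradOp_eq_sum_fdiff, GradOp_eq_sum_fdiff, Matrix.conjTranspose_sum, Matrix.conjTranspose_sum, Matrix.sum_mul, Matrix.mul_sum,
    ← Finset.sum_sub_distrib, YfreeS, Matrix.mul_sum]
  refine Finset.sum_congr rfl fun μ _ => ?_
  rw [Matrix.conjTranspose_mul, Matrix.conjTranspose_mul, Matrix.mul_assoc, ← Matrix.mul_assoc (JK0 N R M), JK0_mul_injMH,
    Matrix.mul_assoc, ← Matrix.mul_sub]
  exact hμ μ

/-- the free part of the split: `(∂′ ⊗ 1)ᴴ(J ⊗ 1) − (J⁰ ⊗ 1)(∂ ⊗ 1)ᴴ = ((1 − Π₀′) ⊗ 1)·Y`. [folklore] -/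
theorem gradH_plant_sub (hd : 1 ≤ d) (hN : 1 ≤ N) :
    (GradOp (fine (R * N) M) (((R * N : ℕ)) : ℂ) ⊗ₖ (1 : Matrix o o ℂ))ᴴ * (JK N R M ⊗ₖ (1 : Matrix o o ℂ))
        - (JK0 N R M ⊗ₖ (1 : Matrix o o ℂ)) * (GradOp (fine N M) ((N : ℕ) : ℂ) ⊗ₖ (1 : Matrix o o ℂ))ᴴ
      = ((1 - Pi0 N R M) ⊗ₖ (1 : Matrix o o ℂ)) * Yfree N R M o := by
  have h := congrArg (fun A => A ⊗ₖ (1 : Matrix o o ℂ)) (gradH_plant_sub_scalar N R M hd hN)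
  rw [sub_kronecker ((GradOp (fine (R * N) M) (((R * N : ℕ)) : ℂ))ᴴ * JK N R M) (JK0 N R M * (GradOp (fine N M) ((N : ℕ) : ℂ))ᴴ),
    kron_mul, kron_mul, kron_mul] at h
  rw [kron_conjTranspose, kron_conjTranspose, Yfree]
  exact h

/-- the connection part of the split, per direction. [folklore] -/
theorem defectH_plant_sub_dir (R₁ : Fin d → (Tor (fine (R * N) M) → Matrix o o ℂ)) (R₀ : Fin d → (Tor (fine N M) → Matrix o o ℂ))
    (μ : Fin d) :
    (siteMul (connL (fine (R * N) M) (((R * N : ℕ)) : ℂ) R₁ μ) * shiftM (fine (R * N) M) μ ⊗ₖ (1 : Matrix o o ℂ)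
          * injM (fine (R * N) M) μ ⊗ₖ (1 : Matrix o o ℂ))ᴴ * (JK N R M ⊗ₖ (1 : Matrix o o ℂ))
        - (JK0 N R M ⊗ₖ (1 : Matrix o o ℂ)) * (siteMul (connL (fine N M) ((N : ℕ) : ℂ) R₀ μ) * shiftM (fine N M) μ ⊗ₖ (1 : Matrix o o ℂ)
          * injM (fine N M) μ ⊗ₖ (1 : Matrix o o ℂ))ᴴ
      = WpartDir N R M R₁ R₀ μ := by
  set w' : Tor (fine (R * N) M) × Fin d → Matrix o o ℂ := fun i' => (connL (fine (R * N) M) (((R * N : ℕ)) : ℂ) R₁ μ i')ᴴ with hw'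
  set w : Tor (fine N M) × Fin d → Matrix o o ℂ := fun i => (connL (fine N M) ((N : ℕ) : ℂ) R₀ μ i)ᴴ with hw
  have e1 : (siteMul (connL (fine (R * N) M) (((R * N : ℕ)) : ℂ) R₁ μ) * shiftM (fine (R * N) M) μ ⊗ₖ (1 : Matrix o o ℂ)
        * injM (fine (R * N) M) μ ⊗ₖ (1 : Matrix o o ℂ))ᴴ
      = (injM (fine (R * N) M) μ)ᴴ ⊗ₖ (1 : Matrix o o ℂ) * ((shiftM (fine (R * N) M) μ)ᴴ ⊗ₖ (1 : Matrix o o ℂ)) * siteMul w' := by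
    rw [Matrix.conjTranspose_mul, Matrix.conjTranspose_mul, kron_conjTranspose, kron_conjTranspose, siteMul_conjTranspose, ← hw', Matrix.mul_assoc]
  have e2 : (JK0 N R M ⊗ₖ (1 : Matrix o o ℂ)) * (siteMul (connL (fine N M) ((N : ℕ) : ℂ) R₀ μ) * shiftM (fine N M) μ ⊗ₖ (1 : Matrix o o ℂ)
        * injM (fine N M) μ ⊗ₖ (1 : Matrix o o ℂ))ᴴ
      = (injM (fine (R * N) M) μ)ᴴ ⊗ₖ (1 : Matrix o o ℂ) * ((JK N R M * (shiftM (fine N M) μ)ᴴ) ⊗ₖ (1 : Matrix o o ℂ)) * siteMul w := by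
    rw [Matrix.conjTranspose_mul, Matrix.conjTranspose_mul, kron_conjTranspose, kron_conjTranspose, siteMul_conjTranspose, ← hw,
      ← Matrix.mul_assoc, ← Matrix.mul_assoc, ← kron_mul, JK0_mul_injMH, kron_mul, kron_mul, Matrix.mul_assoc _ (JK N R M ⊗ₖ _)]
  -- `siteMul (w ∘ parT)·(J ⊗ 1) = (J ⊗ 1)·siteMul w`
  have e3 : siteMul (w ∘ parT N R M) * (JK N R M ⊗ₖ (1 : Matrix o o ℂ)) = JK N R M ⊗ₖ (1 : Matrix o o ℂ) * siteMul w :=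
    (kronJK_mul_siteMul N R M w).symm
  have e4 : siteMul (fun i' => w' i' - w (parT N R M i')) = siteMul w' - siteMul (w ∘ parT N R M) := by
    rw [← siteMul_sub]; rfl
  have key : (shiftM (fine (R * N) M) μ)ᴴ ⊗ₖ (1 : Matrix o o ℂ) * siteMul w' * (JK N R M ⊗ₖ (1 : Matrix o o ℂ))
        - (JK N R M * (shiftM (fine N M) μ)ᴴ) ⊗ₖ (1 : Matrix o o ℂ) * siteMul w
      = (shiftM (fine (R * N) M) μ)ᴴ ⊗ₖ (1 : Matrix o o ℂ) * siteMul (fun i' => w' i' - w (parT N R M i')) * (JK N R M ⊗ₖ (1 : Matrix o o ℂ))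
        + ((shiftM (fine (R * N) M) μ)ᴴ * (1 - faceF N R M μ) * JK N R M * (1 - (shiftM (fine N M) μ)ᴴ)) ⊗ₖ (1 : Matrix o o ℂ)
          * siteMul w := by
    rw [← shiftH_mul_JK_sub, sub_kronecker, kron_mul o ((shiftM (fine (R * N) M) μ)ᴴ) (JK N R M), e4, Matrix.mul_sub, Matrix.sub_mul,
      Matrix.sub_mul, Matrix.mul_assoc _ (siteMul (w ∘ parT N R M)) (JK N R M ⊗ₖ (1 : Matrix o o ℂ)), e3, ← Matrix.mul_assoc]
    abel
  rw [e1, e2]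
  calc (injM (fine (R * N) M) μ)ᴴ ⊗ₖ (1 : Matrix o o ℂ) * ((shiftM (fine (R * N) M) μ)ᴴ ⊗ₖ (1 : Matrix o o ℂ)) * siteMul w'
          * (JK N R M ⊗ₖ (1 : Matrix o o ℂ))
        - (injM (fine (R * N) M) μ)ᴴ ⊗ₖ (1 : Matrix o o ℂ) * ((JK N R M * (shiftM (fine N M) μ)ᴴ) ⊗ₖ (1 : Matrix o o ℂ)) * siteMul w
      = (injM (fine (R * N) M) μ)ᴴ ⊗ₖ (1 : Matrix o o ℂ)
          * ((shiftM (fine (R * N) M) μ)ᴴ ⊗ₖ (1 : Matrix o o ℂ) * siteMul w' * (JK N R M ⊗ₖ (1 : Matrix o o ℂ))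
            - (JK N R M * (shiftM (fine N M) μ)ᴴ) ⊗ₖ (1 : Matrix o o ℂ) * siteMul w) := by
        simp only [Matrix.mul_assoc, Matrix.mul_sub]
    _ = WpartDir N R M R₁ R₀ μ := by rw [key, WpartDir]

/-- **THE EXACT SPLIT** `Θ = ((1 − Π₀′) ⊗ 1)·Y + W`. [folklore] -/
theorem divPlant_eq (hd : 1 ≤ d) (hN : 1 ≤ N) (R₁ : Fin d → (Tor (fine (R * N) M) → Matrix o o ℂ))
    (R₀ : Fin d → (Tor (fine N M) → Matrix o o ℂ)) :
    divPlant N R M R₁ R₀ = ((1 - Pi0 N R M) ⊗ₖ (1 : Matrix o o ℂ)) * Yfree N R M o + Wpart N R M R₁ R₀ := by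
  rw [divPlant, covGrad_eq, covGrad_eq, Matrix.conjTranspose_add, Matrix.conjTranspose_add, Matrix.add_mul, Matrix.mul_add,
    add_sub_add_comm, gradH_plant_sub N R M hd hN, defect, defect, Matrix.conjTranspose_sum, Matrix.conjTranspose_sum, Matrix.sum_mul,
    Matrix.mul_sum, ← Finset.sum_sub_distrib, Wpart]
  congr 1
  exact Finset.sum_congr rfl fun μ _ => defectH_plant_sub_dir N R M R₁ R₀ μ

end Split


end Summit.QuantumFields.BalabanUV.T4Continuum.CovariantDivergencePlanting

end
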